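import Summits.AnomalousDissipation.AnomalousDissipation.Theorems.SolenoidalFractalHomogenisationLagrangianStepDefs
import Summits.AnomalousDissipation.AnomalousDissipation.Theorems.IsotropicCubatureWord
import Mathlib.Analysis.Normed.Algebra.MatrixExponential
import Literature.LinearAlgebra.Matrix.MinkowskiDet

/-!
# K1L `LagrangianRenormalisationStep` / K1L_D — W5-CERT: the SECTORIAL ODD GAIN of the quasi-static map as a REVERSED-MINKOWSKI DEFECT
planner ad-ideate-p5 g7 (lens «profile» = profile-and-certify); crux workfile, NOT a registered line.  Companion memo
`SectorCert-Profile.md` (numbers, kit j309739) and script `sector_cert.py` (float profile + interval branch-and-bound certificate).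

TARGET.  p4's `SectorialOddChannelBound Φν S⋆ λ₀ Λ κ ε` (IntervalWindowFamilySketch §7, l.1408) — the odd half of the sectorial window
clause of `stub_cellLawV` / `stub_cellLawV0_IS` via `sectorialIntervalWindowClause_of_channelBound` + `sector_fix_of_gain_lt_one`
(`κ < 1`, `τlo ≥ ε/(1−κ)`).  This file supplies the finite-dimensional chain that makes `κ` a CERTIFIED number for the principal part
`Φ₀ = N⁻¹·excQS W₀ M` of the one-level map (the pair / mixing terms are a `10⁻⁹`-relative multiplicative resp. `e^{−1.1·10⁵M}` additive
correction, p5 g6 memo `CellLawW-Profile.md`):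

* (L0) LINE FORM (`ExcQSLineForm`, definitional): `bsymb (excQS W M S) k p q = Σ_s c_s (e_s·k)² · pᵀ Q_s(S) q`, `Q_s(S) = f_{T_s}(B̂_s(S))·P_{m_s}`,
  `B̂_s(S)` = the (regularised) transverse block of `S` at the slot direction `m̂_s`.  The map sees `S` ONLY through its 13 line blocks.
* (L1) PER LINE the block map is SECTOR-EXACT for inversion (p4 `sector_inv`, in the tree of sketches) and sector-NON-EXPANDING for the true
  slot function `f_T(z) = ϑ(Tz)/z` (`QsRespSectorNonexpansive`; first-order factor `≤ 1 − 1.5·10⁻⁶` on `[0.4, 2.5]`, kit j309739 Part S).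
* (L2) COMPRESSION `m⊥ → k⊥` (PROVED here, `sectorForm_compress`, `det_compress`, `odd_compress`): congruence by the 2×2 matrix
  `J = B_mᵀB_k` preserves the sector, multiplies `det` by `(det J)² = (m̂·k̂)²` and the odd part by `det J = ±(m̂·k̂)`.
* (L3) REVERSED MINKOWSKI (in the tree: `Literature.LinearAlgebra.Matrix.det_rpow_add_det_rpow_le`, `N = 2`): `√det(ΣA_m) ≥ Σ√det A_m`
  for PSD 2×2 forms ⟹ with (L1),(L2): `OddSectorial S τ → OddSectorial (Φ₀ S) τ` for EVERY `S`, EVERY `τ ≥ 0` — NON-EXPANSION, `κ ≤ 1`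
  with no window at all (`NonExpansion`).
* (L4) THE STRICT GAIN = the Minkowski DEFECT of the 13 compressed line forms (`MinkowskiDefectCert c γ`): over the Thompson ball of
  condition `c = λ²` (every line block has its spectrum in a common box `[y, c·y]`, orientation free — the INDEPENDENT-LINES RELAXATION, an
  upper bound for the true gain over tensors `S`), `Σ_m W_m(k)|m̂_m·k̂| √det Y_m ≤ γ_c · √det_{k⊥}(Σ_m W_m(k) P_k Y_m P_k)`.  Exact value of
  the relaxation (Lorentzian/hyperbolic form: `1/γ(k) = min_{E ∈ SL₂-PD} min_Y ½Σ_m W_m tr(Y_m J_m E⁻¹ J_mᵀ) / Σ_m W_m|μ_m|√det Y_m`, von Neumann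
  anti-alignment + Dinkelbach, separable per line) and the CERTIFIED bounds (interval arithmetic, outward rounding, `+ − × ÷ √` only,
  branch-and-bound over `k`-face × `E`-box): kit j309739 Parts F / C — see the table in `SectorCert-Profile.md` (γ_relax(1) = 0.65497 =
  p5 g6 `γ_AMGM`, γ_relax(2) = 0.8095; certified targets per `c`).
* (L5) COMPOSITION (`oddGain_excQS_candidate`, the candidate W5 text for the principal part): (L0)–(L4) ⟹
  `SectorialOddChannelBoundOn Φ₀ (b•I) 1 λ γ_{c} 0 τ₀` with `c = λ²·(1 + 2·10⁻⁵)` (line-class spread of `3ϑ(T_m·)`), any `b > 0`.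

TYPING REMARK (to p4 / tenure).  `SectorialOddChannelBound` quantifies `∀ τ ≥ 0`; its only consumer uses `τ ∈ [τlo, τhi]`.  In the inversion
model a line with input sector ratio `r ∈ [0, τ]` has its whole output rescaled by `φ(r) = 1/(1+r²/4)` (even block `adj Σ/(det Σ + ω²)`) at output
ratio `r`; since `r·φ(r)` is increasing on `[0, 2]` and `φ` decreasing, `r = τ` is optimal for every line in the Dinkelbach sub-problem when
`τ ≤ 2`, so the relaxed gain is EXACTLY `τ`-independent on `(0, 2]` and the certified `γ_c` holds verbatim there (Part T confirms: 0.654967 at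
`c = 1` for `τ = 0.5, 2, 8, 32`); for the true slot response (per-line data within `1.5·10⁻⁶` of inversion) take `τ₀ ≤ 1`, where the
monotonicity margin `(rφ)' ≥ 0.48` absorbs the deviation.  For all `τ` only non-expansion (`κ ≤ 1`) is claimed.  Hence the LOCAL form `SectorialOddChannelBoundOn … τ₀`
below (`∀ τ ∈ [0, τ₀]`, `τ₀ = 2`): `sectorialIntervalWindowClause_of_channelBound` goes through verbatim with `τhi ≤ τ₀`; nothing is refuted.
-/

set_option linter.dupNamespace false

namespace Summit.AnomalousDissipation.AnomalousDissipation.Cruxes.LagrangianRenormalisationStep.OddGainCertificate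

open Matrix Real Finset
open scoped BigOperators Matrix

open Summit.AnomalousDissipation.AnomalousDissipation.Theorems.SolenoidalFractalHomogenisation.LagrangianStep (mhat)

noncomputable section

/-! ## §0a Vocabulary — VERBATIM copies of p4's `IntervalWindowFamilySketch` definitions (`T4`, `TransLE`, `TransNonneg`, `InInterval` §1,
`OddSectorial` §6, `SectorialOddChannelBound` §7; file of 2026-08-28 12:55Z), so that this workfile elaborates without importing that
(frequently rebuilt) sketch.  Same names; the statements below are literally p4's after `open`. -/

/-- Shapes = viscosity 4-tensors on `𝕋³` (p4). -/
abbrev T4 : Type := Literature.Analysis.FluidPDE.Torus.Visc4 (Fin 3)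

/-- p4 `TransLE`: transverse Loewner preorder. -/
def TransLE (S S' : T4) : Prop :=
  ∀ k p : Fin 3 → ℝ, ∑ i, p i * k i = 0 → Literature.Analysis.FluidPDE.Torus.symb S k p ≤ Literature.Analysis.FluidPDE.Torus.symb S' k p

/-- p4 `TransNonneg`. -/
def TransNonneg (S : T4) : Prop :=
  ∀ k p : Fin 3 → ℝ, ∑ i, p i * k i = 0 → 0 ≤ Literature.Analysis.FluidPDE.Torus.symb S k p

/-- p4 `InInterval`: the order interval `S⋆/λ ≼ S ≼ λ S⋆`. -/
def InInterval (Sstar : T4) (lam : ℝ) (S : T4) : Prop :=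
  TransLE ((1 / lam) • Sstar) S ∧ TransLE S (lam • Sstar)

/-- p4 `OddSectorial`: Kato sector of half-angle `arctan τ` for every transverse block. -/
def OddSectorial (S : T4) (τ : ℝ) : Prop :=
  ∀ k p q : Fin 3 → ℝ, ∑ i, p i * k i = 0 → ∑ i, q i * k i = 0 →
    (Literature.Analysis.FluidPDE.Torus.bsymb S k p q - Literature.Analysis.FluidPDE.Torus.bsymb S k q p) ^ 2 ≤
      τ ^ 2 * (Literature.Analysis.FluidPDE.Torus.symb S k p * Literature.Analysis.FluidPDE.Torus.symb S k q)

/-- p4 `SectorialOddChannelBound` (the W5 input of `stub_cellLawV` / `stub_cellLawV0_IS`). -/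
def SectorialOddChannelBound (Φν : T4 → T4) (Sstar : T4) (lam₀ Λ κ ε : ℝ) : Prop :=
  ∀ lam ∈ Set.Icc lam₀ Λ, ∀ S : T4, ∀ τ : ℝ, 0 ≤ τ → InInterval Sstar lam S → OddSectorial S τ → OddSectorial (Φν S) (κ * τ + ε)

/-! ## §0b The quasi-static response (verbatim copies of `LoewnerWindowSketch.qsResp / excQS`, p5 g3, so that this file does not import
that workfile) -/

/-- `f_T(B) = T ∫₀¹ a(s) ∫₀ˢ a(x) e^{−T(s−x)B} dx ds` (unit trapezoid slot, ramp `ρ`), entrywise; scalar case `f_T(x) = ϑ(ρ,Tx)/x`. -/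
def qsResp (ρ T : ℝ) (B : Matrix (Fin 3) (Fin 3) ℝ) : Matrix (Fin 3) (Fin 3) ℝ := fun i j =>
  T * ∫ s in (0:ℝ)..1, Literature.Analysis.FluidPDE.LatticeShear.LatticeWord.trapezoid 0 1 ρ s *
    ∫ x in (0:ℝ)..s, Literature.Analysis.FluidPDE.LatticeShear.LatticeWord.trapezoid 0 1 ρ x * (NormedSpace.exp (-(T * (s - x)) • B)) i j

/-- The quasi-static excess tensor of the word `W` pre-stretched by `M` at background `S` (per unit `1/ν²`). -/
def excQS {k : ℕ} (W : Literature.Analysis.FluidPDE.LatticeShear.LatticeWord k) (M : ℝ) (S : T4) : T4 := fun i a j b =>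
  ∑ s, (let P := W.phase s
    let mn : ℝ := ‖Literature.Analysis.FunctionSpaces.Torus.latticeVec P.m‖
    let Sig : Matrix (Fin 3) (Fin 3) ℝ := fun i' j' => ∑ a', ∑ b', S i' a' j' b' * mhat P a' * mhat P b'
    let Pm : Matrix (Fin 3) (Fin 3) ℝ := fun i' j' => (if i' = j' then 1 else 0) - mhat P i' * mhat P j'
    let Q : Matrix (Fin 3) (Fin 3) ℝ := qsResp W.ramp (4 * Real.pi ^ 2 * mn ^ 2 * M * P.τ) (Pm * Sig * Pm + Matrix.vecMulVec (mhat P) (mhat P)) * Pm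
    P.τ / (2 * (2 * Real.pi * mn) ^ 4) / W.period * (P.e a * P.e b) * Q i j)

/-! ## §1 Sector forms on finite-dimensional blocks and the compression lemmas (L2) -/

/-- The Kato-sector condition for a real square matrix `B` (the hypothesis shape of p4's `sector_inv`): the antisymmetric part of the
bilinear form is at most `τ` times the geometric mean of the quadratic form at the two arguments. -/
def SectorForm {n : ℕ} (B : Matrix (Fin n) (Fin n) ℝ) (τ : ℝ) : Prop :=
  ∀ x y : Fin n → ℝ, (x ⬝ᵥ B *ᵥ y - y ⬝ᵥ B *ᵥ x) ^ 2 ≤ τ ^ 2 * ((x ⬝ᵥ B *ᵥ x) * (y ⬝ᵥ B *ᵥ y))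

/-- (L2a) **Congruence preserves the sector**: `B ↦ Jᵀ B J` (compression of a block on `m⊥` to `k⊥` is the case `J = B_mᵀ B_k`). -/
theorem sectorForm_compress {n l : ℕ} {B : Matrix (Fin n) (Fin n) ℝ} {τ : ℝ} (h : SectorForm B τ) (J : Matrix (Fin n) (Fin l) ℝ) :
    SectorForm (Jᵀ * B * J) τ := by
  intro x y
  have key : ∀ u v : Fin l → ℝ, u ⬝ᵥ (Jᵀ * B * J) *ᵥ v = (J *ᵥ u) ⬝ᵥ B *ᵥ (J *ᵥ v) := by
    intro u v
    rw [← Matrix.mulVec_mulVec, ← Matrix.mulVec_mulVec, Matrix.dotProduct_mulVec, Matrix.vecMul_transpose]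
  rw [key, key, key, key]
  exact h (J *ᵥ x) (J *ᵥ y)

/-- (L2b) `det (Jᵀ Y J) = (det J)² · det Y` (for the plane-to-plane compression `det J = ±(m̂·k̂)`). -/
theorem det_compress {l : ℕ} (Y J : Matrix (Fin l) (Fin l) ℝ) : (Jᵀ * Y * J).det = J.det ^ 2 * Y.det := by
  rw [Matrix.det_mul, Matrix.det_mul, Matrix.det_transpose]; ring

/-- (L2c) the odd part of a 2×2 block scales by `det J` under congruence. -/
theorem odd_compress (Y J : Matrix (Fin 2) (Fin 2) ℝ) :
    (Jᵀ * Y * J) 0 1 - (Jᵀ * Y * J) 1 0 = J.det * (Y 0 1 - Y 1 0) := by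
  simp only [Matrix.mul_apply, Matrix.transpose_apply, Fin.sum_univ_two, Matrix.det_fin_two]
  ring

/-- (L2d) for a 2×2 block, `SectorForm` is the single inequality `(B₀₁ − B₁₀)² ≤ τ²·det(sym B)` once the symmetric part is positive
semidefinite (Gram identity `(xᵀΣx)(yᵀΣy) − (xᵀΣy)² = det Σ · det[x y]²`).  Stated; the Theorems-side proof is a `nlinarith` exercise. -/
def SectorFormTwoIff : Prop :=
  ∀ (B : Matrix (Fin 2) (Fin 2) ℝ) (τ : ℝ), 0 ≤ B 0 0 → 0 ≤ B 1 1 → (B 0 1 + B 1 0) ^ 2 ≤ 4 * (B 0 0 * B 1 1) →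
    (SectorForm B τ ↔ (B 0 1 - B 1 0) ^ 2 ≤ τ ^ 2 * (B 0 0 * B 1 1 - ((B 0 1 + B 1 0) / 2) ^ 2))

/-! ## §2 (L0) the line form of `excQS` and (L1) per-line sector behaviour of the slot response -/

/-- The regularised transverse block of `S` at the slot direction of phase `P` (exactly the argument of `qsResp` inside `excQS`). -/
def slotBlock (P : Literature.Analysis.FluidPDE.LatticeShear.LatticePhase) (S : T4) : Matrix (Fin 3) (Fin 3) ℝ :=
  let Sig : Matrix (Fin 3) (Fin 3) ℝ := fun i' j' => ∑ a', ∑ b', S i' a' j' b' * mhat P a' * mhat P b'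
  let Pm : Matrix (Fin 3) (Fin 3) ℝ := fun i' j' => (if i' = j' then 1 else 0) - mhat P i' * mhat P j'
  Pm * Sig * Pm + Matrix.vecMulVec (mhat P) (mhat P)

/-- The projector `P_m = 1 − m̂ m̂ᵀ` of phase `P`. -/
def slotProj (P : Literature.Analysis.FluidPDE.LatticeShear.LatticePhase) : Matrix (Fin 3) (Fin 3) ℝ :=
  fun i' j' => (if i' = j' then 1 else 0) - mhat P i' * mhat P j'

/-- (L0) **LINE FORM of `excQS`** (definitional after exchanging the finite sums): the bilinear transverse symbol of `excQS W M S` at ANY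
`k, p, q` is the slot sum of `c_s · (e_s·k)² · pᵀ (f_{T_s}(B̂_s(S)) P_s) q` — the map sees `S` only through its slot blocks, the
`k`-dependence is the explicit scalar weight `(e_s·k)²`. -/
def ExcQSLineForm : Prop :=
  ∀ (n : ℕ) (W : Literature.Analysis.FluidPDE.LatticeShear.LatticeWord n) (M : ℝ) (S : T4) (k p q : Fin 3 → ℝ),
    Literature.Analysis.FluidPDE.Torus.bsymb (excQS W M S) k p q =
      ∑ s, (W.phase s).τ / (2 * (2 * Real.pi * ‖Literature.Analysis.FunctionSpaces.Torus.latticeVec (W.phase s).m‖) ^ 4) / W.period *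
        (∑ a, (W.phase s).e a * k a) ^ 2 *
        (p ⬝ᵥ (qsResp W.ramp (4 * Real.pi ^ 2 * ‖Literature.Analysis.FunctionSpaces.Torus.latticeVec (W.phase s).m‖ ^ 2 * M * (W.phase s).τ)
          (slotBlock (W.phase s) S) * slotProj (W.phase s)) *ᵥ q)

/-- (L1) **PER-LINE SECTOR NON-EXPANSION of the slot response** (band form; `τ ≤ τ₀` kept as a parameter, `τ₀ = ∞` is what the numbers
support): `SectorForm B τ → SectorForm (f_T(B)) τ` for the quasi-static response `f_T = qsResp ρ T` when the symmetric part of `B` has spectrum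
in `[lo, hi]`.  For `f = const/z` this is EXACT for every `τ` (p4 `sector_inv`).  For `f_T(z) = ϑ(Tz)/z` the 2×2 functional calculus
`f(B) = ½(f(λ₊)+f(λ₋))·1 + f[λ₊,λ₋]·(B − ½tr B)` (complex conjugate `λ±` when the odd part exceeds the anisotropy) gives the EXACT sector factor
`√(A₁²(α²−ρ²)/(A₀²−A₁²ρ²))`; evaluated on `σ ∈ [0.4, 2.5]`, `T ∈ {1579, 10107, 28780}` (the three line classes at `M = 1`), ALL
`τ ∈ [10⁻⁴, 10⁴]` (p5 g7 `l1_exact_check.py`): factor − 1 ∈ `[−1.5·10⁻⁶, 0]` / `[−3.8·10⁻⁸, 0]` / `[−4.6·10⁻⁹, 0]`, strict for `τ ≤ 10⁻²`,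
`→ 1⁻` like `6·10⁻⁸/τ²` (the inversion limit) — never expanding.  WHY IT MIGHT FAIL: outside the band (`T·σ ≲ 50`, i.e. `M·b` tiny) the
phase of `ϑ(T(α+iω))` is no longer small; irrelevant for `M ≥ 1`, `b ≥ 0.4`. -/
def QsRespSectorNonexpansive (ρ T lo hi τ₀ : ℝ) : Prop :=
  ∀ (B : Matrix (Fin 3) (Fin 3) ℝ) (τ : ℝ), 0 ≤ τ → τ ≤ τ₀ → SectorForm B τ →
    (∀ x : Fin 3 → ℝ, lo * (x ⬝ᵥ x) ≤ x ⬝ᵥ B *ᵥ x ∧ x ⬝ᵥ B *ᵥ x ≤ hi * (x ⬝ᵥ x)) →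
    SectorForm (qsResp ρ T B) τ

/-! ## §3 (L3) non-expansion and (L4) the Minkowski-defect certificate -/

/-- The LOCAL (τ-restricted) form of p4's `SectorialOddChannelBound` — identical except `τ ∈ [0, τ₀]`.  Its consumer
`sectorialIntervalWindowClause_of_channelBound` only ever instantiates `τ ∈ [τlo, τhi]`, so with `τhi ≤ τ₀` nothing downstream changes. -/
def SectorialOddChannelBoundOn (Φν : T4 → T4) (Sstar : T4) (lam₀ Λ κ ε τ₀ : ℝ) : Prop :=
  ∀ lam ∈ Set.Icc lam₀ Λ, ∀ S : T4, ∀ τ ∈ Set.Icc 0 τ₀, InInterval Sstar lam S → OddSectorial S τ → OddSectorial (Φν S) (κ * τ + ε)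

theorem sectorialOddChannelBoundOn_of_global {Φν : T4 → T4} {Sstar : T4} {lam₀ Λ κ ε : ℝ}
    (h : SectorialOddChannelBound Φν Sstar lam₀ Λ κ ε) (τ₀ : ℝ) : SectorialOddChannelBoundOn Φν Sstar lam₀ Λ κ ε τ₀ :=
  fun lam hlam S τ hτ hSi hSo => h lam hlam S τ hτ.1 hSi hSo

/-- (L3) **NON-EXPANSION** (candidate, M-sized given (L0)–(L2)): a line-structured map whose slot responses are sector-non-expanding maps
the sector `τ` into itself for EVERY background — no window needed.  Ingredients: `ExcQSLineForm`, `QsRespSectorNonexpansive`,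
`sectorForm_compress`, and closure of the sector under nonnegative sums (p4 `OddSectorial.add` / `sector_add_aux`, i.e. reversed
Minkowski `det_rpow_add_det_rpow_le` at `N = 2`).  Stated for the normalised quasi-static excess of any lattice word. -/
def NonExpansion : Prop :=
  ∀ (n : ℕ) (W : Literature.Analysis.FluidPDE.LatticeShear.LatticeWord n) (M N lo hi τ₀ : ℝ), 0 < M → 0 < N → 0 < lo →
    (∀ s, QsRespSectorNonexpansive W.ramp (4 * Real.pi ^ 2 * ‖Literature.Analysis.FunctionSpaces.Torus.latticeVec (W.phase s).m‖ ^ 2 * M * (W.phase s).τ) lo hi τ₀) →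
    ∀ (S : T4) (τ : ℝ), 0 ≤ τ → τ ≤ τ₀ → Literature.Analysis.FluidPDE.Torus.NearIso S lo hi → OddSectorial S τ →
      OddSectorial ((1 / N) • excQS W M S) τ

/-- The 13 LINES of the cubature word `W₀` (axes, face diagonals, body diagonals) … -/
def lineVec : Fin 13 → Fin 3 → ℝ :=
  ![![1, 0, 0], ![0, 1, 0], ![0, 0, 1], ![1, 1, 0], ![1, -1, 0], ![1, 0, 1], ![1, 0, -1], ![0, 1, 1], ![0, 1, -1],
    ![1, 1, 1], ![1, 1, -1], ![1, -1, 1], ![1, -1, -1]]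

/-- … and their line weights `τ_m/|m|⁴` (`40`, `128/4 = 32`, `243/9 = 27`): with the two orthonormal slots `e, e'` of a line,
`Σ_{s ∈ m} c_s (e_s·k)² = (τ_m/|m|⁴)·(|k|² − (m̂·k)²)` up to the common factor `1/(2(2π)⁴·period)`. -/
def lineWt : Fin 13 → ℝ := ![40, 40, 40, 32, 32, 32, 32, 32, 32, 27, 27, 27, 27]

/-- unit line direction -/
def lineDir (m : Fin 13) : Fin 3 → ℝ := fun i => lineVec m i / Real.sqrt (∑ j, lineVec m j ^ 2)

/-- `e₂(X) = ((tr X)² − tr(X²))/2`: for a symmetric 3×3 form vanishing on a unit vector `u` this is the determinant of its restriction to `u⊥`. -/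
def e2 (X : Matrix (Fin 3) (Fin 3) ℝ) : ℝ := ((Matrix.trace X) ^ 2 - Matrix.trace (X * X)) / 2

/-- projector onto `k⊥` for a unit `k` -/
def proj (k : Fin 3 → ℝ) : Matrix (Fin 3) (Fin 3) ℝ := 1 - Matrix.vecMulVec k k

/-- (L4) **THE MINKOWSKI-DEFECT CERTIFICATE at box ratio `c` with constant `γ`** (finite-dimensional, CHECKABLE): for every unit output
direction `k` and every family of 13 positive semidefinite line forms `Y_m` supported on `m̂_m⊥` whose transverse spectra lie in a COMMON box
`[y, c·y]` (the independent-lines relaxation of "`S` in the Thompson ball of condition `c` about `b·I`", orientation free),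
`Σ_m W_m(k)·|m̂_m·k|·√det_{m⊥} Y_m ≤ γ · √det_{k⊥}(Σ_m W_m(k)·P_k Y_m P_k)`, `W_m(k) = lineWt m · (1 − (m̂_m·k)²)`.
By reversed Minkowski it holds with `γ = 1` for every `c`; the CONTENT is `γ < 1`.  Numbers (kit j309739): exact relaxed optimum
`γ_relax(c)` = 0.654967 (c = 1, = p5 g6 `γ_AMGM`, direction `(0.8986, 0.3958, 0.1892)`), 0.748649 (1.5), 0.809477 (2), 0.858310 (2.6), 0.881628 (3),
0.920946 (4), 0.960032 (6); INTERVAL-CERTIFIED: `MinkowskiDefectCert 1.5 0.795`, `… 2 0.86`, `… 2.6 0.91`, `… 3 0.99` (deeper targets: kit j310341).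
WHY IT MIGHT FAIL: it cannot at the certified pairs (interval proof); the risk is only that the needed `c = λ²` of the design exceeds the
table (γ_relax ↑ 1 as `c → ∞`). -/
def MinkowskiDefectCert (c γ : ℝ) : Prop :=
  ∀ (k : Fin 3 → ℝ), ∑ i, k i ^ 2 = 1 →
  ∀ (Y : Fin 13 → Matrix (Fin 3) (Fin 3) ℝ) (y : ℝ), 0 < y →
    (∀ m, (Y m).IsSymm ∧ (Y m) *ᵥ lineDir m = 0 ∧
      ∀ p : Fin 3 → ℝ, p ⬝ᵥ lineDir m = 0 → y * (p ⬝ᵥ p) ≤ p ⬝ᵥ (Y m) *ᵥ p ∧ p ⬝ᵥ (Y m) *ᵥ p ≤ c * y * (p ⬝ᵥ p)) →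
    ∑ m, lineWt m * (1 - (lineDir m ⬝ᵥ k) ^ 2) * |lineDir m ⬝ᵥ k| * Real.sqrt (e2 (Y m)) ≤
      γ * Real.sqrt (e2 (∑ m, (lineWt m * (1 - (lineDir m ⬝ᵥ k) ^ 2)) • (proj k * Y m * proj k)))

/-- The EXACT relaxed value in Lorentzian form (documentation of what Parts F/C compute; `E` ranges over `det E = 1` positive definite 2×2,
`G_m = J_m E⁻¹ J_mᵀ` with eigenvalues `g₁ ≥ g₂`, `J_m = B_mᵀ B_k`):
`γ_relax(k; c) = max_E max_{y ≤ y₂ ≤ y₁ ≤ c·y} Σ_m W_m|μ_m| √(y₁y₂) / (½ Σ_m W_m (y₁ g₂ + y₂ g₁))` — von Neumann's trace inequality makes the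
inner maximisation separable per line with closed-form edge maximisers; Dinkelbach iteration converges to the ratio.  Interval version: the
per-line data `(W_m|μ_m|)⁺`, `tr G_m⁻`, `g₂⁻ = 2 det/(tr⁺ + √(tr⁺² − 4 det⁻))` (`det G_m = W_m² μ_m²` exactly since `det E = 1`). -/
def relaxedValueDoc : Prop := True

/-! ## §4 (L5) the composed candidate W5 text for the principal part -/

/-- (L5) **CANDIDATE W5 TEXT for `Φ₀ = N⁻¹·excQS W₀ M`** (principal part of the one-level map; pair terms ×(1 ± 10⁻⁹), mixing source
additive `ε_ν`): from (L0)–(L4), for the `b·I`-centred Thompson ball of radius `λ ≤ Λ`, `SectorialOddChannelBoundOn Φ₀ (b•I) 1 Λ γ 0 τ₀`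
whenever `MinkowskiDefectCert (Λ²·(1 + 2·10⁻⁵)) γ` (the factor absorbs the line-class spread of `3ϑ(T_m b') ∈ [1 − 5·10⁻⁶, 1]`, `b' ≥ 0.4`),
the per-slot non-expansion holds on the band, and `τ₀ ≤ 2` (exact `τ`-independence of the relaxed gain, module docstring).  The assembly is: line form (L0) ⟹ output block at `k` = `Σ_m W_m(k) J_mᵀ F_m(B̂_m) J_m`;
(L1) each `F_m(B̂_m)` is in sector `τ` with even part `Y_m` of spectrum in `f_{T_m}([b/λ, bλ]) ⊂ [y, c y]`; (L2) odd parts compress by `μ_m`,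
determinants by `μ_m²`; so `|2·odd_out(k)| ≤ τ Σ_m W_m|μ_m|√det Y_m ≤ τ·γ·√det(even_out(k))` by (L4) = `OddSectorial (Φ₀ S) (γτ)` via (L2d). -/
def oddGain_excQS_candidate (M N b Λ γ τ₀ : ℝ) : Prop :=
  0 < M → 0 < N → 0 < b → 1 ≤ Λ → τ₀ ≤ 2 → MinkowskiDefectCert (Λ ^ 2 * (1 + 2e-5)) γ →
  (∀ s, QsRespSectorNonexpansive
      (Summit.AnomalousDissipation.AnomalousDissipation.Theorems.cubatureWord).ramp
      (4 * Real.pi ^ 2 * ‖Literature.Analysis.FunctionSpaces.Torus.latticeVec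
        ((Summit.AnomalousDissipation.AnomalousDissipation.Theorems.cubatureWord).phase s).m‖ ^ 2 * M *
        ((Summit.AnomalousDissipation.AnomalousDissipation.Theorems.cubatureWord).phase s).τ)
      (b / Λ) (b * Λ) τ₀) →
  SectorialOddChannelBoundOn
    (fun S => (1 / N) • excQS Summit.AnomalousDissipation.AnomalousDissipation.Theorems.cubatureWord M S)
    (b • Literature.Analysis.FluidPDE.Torus.isoVisc 1) 1 Λ γ 0 τ₀

end

end Summit.AnomalousDissipation.AnomalousDissipation.Cruxes.LagrangianRenormalisationStep.OddGainCertificate
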